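/-
Copyright (c) 2026 the pub-hodgecm-mathlib formalisation cell (harness21).  Prover seat hodgecm-mathlib-K2E2-p12 (g2), Track B «K2-LIT», engine E2, unit CAPTURE,
socket #20a line lead, 2026-09-04.  KERNEL module: THEOREMS ONLY (no definition, no named fact, no `sorry`, no instance, no notation).
-/
import Summits.HodgeConjecture.HodgeConjecture.Theorems.K2E2CapArchPackagedHolCot        -- ★ H1′-final, model spelling (this seat): `linePair_frame_of_packaged`
import Literature.NumberTheory.Automorphic.Liu2021.Def411WeilCarriersFrameTransport          -- ★ `lineW_realDiagonal`, `realDiagonal_lineW`, `chiSplittingLine_realDiagonal`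
import HarnessLib

set_option autoImplicit false
set_option linter.dupNamespace false

/-!
# K2 ∕ E2 «ThetaExhaustionByRigidity», unit CAPTURE, socket #20a «ARCH-PAIR-HOLCOT» — THE CAST from the model line spelling
# `(realDiagonal (lineVec a), diagonal (lineVec a), chiSplitting)` to the letter's `(T_W, J_W, chiSplittingLine)` of ★ H1′-final

Cell hodgecm-mathlib (D-0151), FLOOR 0, Track B «K2-LIT», engine E2, crux item H413 = stmt-HodgeConjecture-24833 (route `HCCMUnconditional`).  Socket #20a
`Capture.sig_K2E2CapArchPairHolCot` (bytes 3efc5e019e17f8df); line lead K2E2-p12 (g2).  ROAD b2 «BRIDGE»: #20a = «#20a-CAN» (THIS FILE) + «#20a-NONCAN» (H4,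
K2E2-p13, the orientation mirror, from «#20a-CAN»).  «#20a-CAN» = the #20a bytes with ONE extra hypothesis `(InfinitePlace.mk ι).embedding = ι →` after the
`2 ≤ [L⁺:ℚ]` arrow (interface of record, K2 bus 2026-09-04T00:15:46Z; text `K2/K2E2-p12/g2/ARCH-PAIR-HOLCOT-CAN.txt`).

PROOF.  ★ H2 `K2E2CapArchPairFrameTransport.capArchPairHolCot_frameTransport` reduces the letter (all frames `(e₁, dV, g, ιV)`) to ONE frame; we take the
PACKAGED frame `(ArchSideTerm.e₁, frameD V, frameG V)` of `V := hermSpace3Of L ι H T hT ‹hpos›` over `F := cmFieldOf L` (`K F = L`, `Hm V = H` by `rfl`).  There,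
§2 replays the engine's preamble (★ `F0P2sThetaOccursInEngineGen`: the admissible representative `e := a∕2δ`, the slot sign, the junction `ĉ` with Liu's twist
equation, the knob `ν`, the centre identity (CC₀), `harm`∕`hdef`) and feeds ★ H1′-final `K2E2CapArchPackagedHolCot.linePair_frame_of_packaged` through §1, the
cast from the model's line spelling `(realDiagonal (lineVec a), diagonal (lineVec a), chiSplitting)` to the letter's `(T_W a, J_W a, chiSplittingLine)` (★
`forall_line_of_forall_realDiagonal`'s `subst` technique + ★ `chiSplittingLine_realDiagonal` + ★ `thetaLift_congr_splitting` ∕ ★ `archWeilRep_congr_splitting`).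
`--supports stmt-HodgeConjecture-24833 --as helper`; THEOREMS ONLY; imports ★ only.  HONEST LABEL: HC_CM is proved only modulo the 7 printed citations (2 remaining
named inputs: hLiu418 = stmt-HodgeConjecture-24832, h413 = stmt-HodgeConjecture-24833) until rung 0 closes; this file discharges no printed citation and pays
no socket by itself (#20a needs «#20a-NONCAN» too).
References: [Liu2021] Camb. J. Math. 9 (2021) Def. 4.11–4.12, App. D §D.1 Steps 1–3, Lem. D.2; [GelbartRogawski1991] Invent. Math. 105 (1991) §3.1;
[BorelJacquet1979] PSPM 33.1 §4.1–4.2; [KonnoKonno2007] Kyushu J. Math. 61 (2007) Thm 5.4; [Weil1964] Acta Math. 111 (1964) n° 41.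
-/

noncomputable section


open NumberField hiding relNormOneIdeles relNormOneRat probHaarRelNormOneQuot
open MulAction NumberField.InfinitePlace NumberField.mixedEmbedding IsDedekindDomain
open _root_.MeasureTheory _root_.MeasureTheory.Measure
open scoped SchwartzMap TensorProduct Classical Matrix ComplexConjugate NNReal
open Literature.NumberTheory.Automorphic Literature.NumberTheory.Automorphic.UnitaryGroup Literature.NumberTheory.Weil1964
open Literature.NumberTheory.Weil1964.ThetaKernelDatum Literature.NumberTheory.Li1992
open Literature.Geometry.ComplexHyperbolic.BallModel (U21 x₀)
open Literature.AlgebraicGeometry.ShimuraVarieties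
open Literature.AlgebraicGeometry.Motives (CMType)
open Literature.NumberTheory.GelbartRogawski1991 Literature.NumberTheory.GelbartRogawski1991.UnitaryDualPair
open Literature.NumberTheory.GelbartRogawski1991.UnitaryDualPair.WeilCoinv (commute_comp_inl_comp_inr finPairToAdelic finPairRep)
open Literature.NumberTheory.Automorphic.Liu2021
open Literature.NumberTheory.Automorphic.Liu2021.Def411WeilCarriers (omegaAtLine rhoVAtLine Chi TW JW JW_eq isSymm_TW isUnit_det_TW lineChar locF)
open Literature.NumberTheory.Automorphic.Liu2021.Def411WeilCarriersDoubling
open Literature.NumberTheory.GaloisRepresentations (HeckeCharacter)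
open Literature.RepresentationTheory.HarrisKudlaSweet1996 (IsSplittingChar)
open Literature.RepresentationTheory.CompactGroups (charCM)
open Literature.MeasureTheory.Group
open HodgeCM HodgeCM.Adelic HodgeCM.PerL34 HodgeCM.Model HodgeCM.Model.ThetaSpace HodgeCM.Model.ArchSideTerm HodgeCM.Model.ThetaAdelicSide
open HodgeCM.Model.ThetaDistFin HodgeCM.Model.HypCensus HodgeCM.Model.LiuIndex HodgeCM.Model.TowerCarrier HodgeCM.Model.SupplyResidual
open HodgeCM.Model.SupplyResidual.WeilPairData (charInv charInv_apply)
open Literature.Analysis.SegalBargmann (binvPi)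
open Literature.AlgebraicGeometry.ShimuraVarieties (BallForms.isPullbackCocycle_cotangentCocycle BallForms.expP)
open Literature.AlgebraicGeometry.Liu2021 (IsAdmissibleElement)
open Summit.HodgeConjecture.CorCM Summit.HodgeConjecture.CorCM.Model Summit.HodgeConjecture.CorCM.Transposition
open Summit.HodgeConjecture.CorCM.Transposition.OmegaChiSplitting (hsChiD)
open Summit.HodgeConjecture.HodgeConjecture.Cruxes.H413.CohFormsCarriers
open Summit.HodgeConjecture.HodgeConjecture.Cruxes.H413.CuspCot
open Summit.HodgeConjecture.HodgeConjecture.Cruxes.H413.ThetaDistAtLine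
open Summit.HodgeConjecture.HodgeConjecture.Cruxes.H413.AdmissibleLine
open Summit.HodgeConjecture.HodgeConjecture.Cruxes.H413.ThetaNonvanishing
open Summit.HodgeConjecture.HodgeConjecture.Cruxes.H413.RallisTransport
open Summit.HodgeConjecture.HodgeConjecture.Cruxes.H413.ThetaJunction

open scoped ComplexOrder
open Literature.NumberTheory.Automorphic.UnitaryGroup.CotangentForms
open Literature.NumberTheory.Automorphic.Liu2021.Def411WeilCarriers
open Literature.NumberTheory.Automorphic.IdeleClassGroup
open Summit.HodgeConjecture.HodgeConjecture.Cruxes.H413.K2E2CapArchPackagedLineLift (thetaLift_congr_splitting)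
open Summit.HodgeConjecture.HodgeConjecture.Cruxes.H413.K2E2CapArchPackagedHolCot (linePair_frame_of_packaged)
open Literature.RepresentationTheory.Liu2021 (isOscillatorChar_toHeckeCharacter_iff)
namespace Summit.HodgeConjecture.HodgeConjecture.Cruxes.H413.K2E2CapArchPairHolCotLineCast

set_option synthInstance.maxHeartbeats 400000 in
set_option maxHeartbeats 16000000 in
/-- **§1 THE CAST TO THE LETTER'S LINE SPELLING**: ★ H1′-final `linePair_frame_of_packaged` (model spelling `(realDiagonal (lineVec a), diagonal (lineVec a),
chiSplitting)`) read at ANY hermitian line datum `(T_W, J_W = T_W ⊗ L)` with `lineW T_W = lineVec a` and the letter's splitting `chiSplittingLine … T_W J_W` — the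
line datum IS `(realDiagonal (lineVec a), diagonal (lineVec a))` (★ `realDiagonal_lineW`, `lineW_realDiagonal`, two `subst`s) and the splittings agree (★
`chiSplittingLine_realDiagonal`; the `Prop` arguments are irrelevant: ★ `thetaLift_congr_splitting`, ★ `archWeilRep_congr_splitting`).
[cite: Liu2021, Def. 4.11 (l. 2092–2096); App. D §D.1 Steps 1–2 (l. 5217–5219)] [cite: GelbartRogawski1991, §3.1 Prop. 3.1.1 p. 455] -/
theorem linePair_frame_line :
    ∀ (F : HodgeCM.CMField) {ι₁ : F →+* ℂ} (V : HodgeCM.HermSpace3 F ι₁) (h4 : 4 ≤ Module.finrank ℚ F.K) (Φ : CMType F)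
      (μ₀ : Literature.NumberTheory.Automorphic.IdeleClassGroup F.K →ₜ* Circle)
      (hμ₀ : Literature.NumberTheory.Automorphic.IdeleClassGroup.IsConjugateSymplectic F.K μ₀)
      (hw : Literature.NumberTheory.Automorphic.IdeleClassGroup.HasWeight F.K μ₀ 1)
      (hmem : (InfinitePlace.mk ι₁).embedding ∈ hμ₀.cmType.1)
      (χ : Chi (↥(maximalRealSubfield F.K)) F.K (IsCMField.complexConj F.K))
      (e : F.K) (a : (↥(maximalRealSubfield F.K))ˣ)
      (he : Literature.AlgebraicGeometry.Liu2021.IsAdmissibleElement F.K hμ₀.cmType.1 e)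
      (hae : (a : F.K) = e * (2 * imagUnit F.K)),
      ∀ (hV : IsAnisotropic F (HodgeCM.HermSpace3.Hm V)) (ha : IsCMField.complexConj F.K (a : F.K) = (a : F.K)) (ha0 : (a : F.K) ≠ 0)
      (hpos : 0 < cmXW F.K (frameD V) (lineVec F.K (dW (cDiag Φ ι₁ (a : F.K) ha ha0).D 0)) (fun _ => dW_real (cDiag Φ ι₁ (a : F.K) ha ha0).D 0) ι₁ (cmPlace
          F.K ι₁) 0)
      (ĉ : UnitaryGroup.adelicPair (↥(maximalRealSubfield F.K)) F.K (IsCMField.complexConj F.K) 3 1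
        (Matrix.diagonal (frameD V)) (Matrix.diagonal (lineVec F.K (a : F.K))) →* ℂˣ),
      (chiSplitting F.K e₁ (frameD V) (frameD_real V) (frameD_ne V) (lineVec F.K (a : F.K)) (complexConj_lineVec_coe F.K a) (lineVec_coe_ne_zero F.K a)
          (Literature.NumberTheory.Automorphic.IdeleClassGroup.toHeckeCharacter F.K μ₀) (Literature.NumberTheory.Automorphic.IdeleClassGroup.isUnitary_toHeckeCharacter F.K μ₀)
              ((Literature.RepresentationTheory.Liu2021.isOscillatorChar_toHeckeCharacter_iff μ₀).mpr hμ₀)) =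
        adelicMpCont.twist (↥(maximalRealSubfield F.K)) (Fin 3) _ (splittingOf _ _ _ _ _ _ _ _ _ _ _ _ _ _ _ _ _ (compat_line₀ V Φ ι₁ (a : F.K) ha ha0)) ĉ →
      (∀ γU ∈ (UnitaryGroup.toAdelic (↥(maximalRealSubfield F.K)) F.K (IsCMField.complexConj F.K) 3 (Matrix.diagonal (frameD V))).range, ĉ ((UnitaryGroup.adelicInl
          (↥(maximalRealSubfield F.K)) F.K (IsCMField.complexConj F.K) 3 1 (Matrix.diagonal (frameD V)) (Matrix.diagonal (lineVec F.K (a : F.K)))) γU) = 1) →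
      (∀ γ ∈ (UnitaryGroup.toAdelic (↥(maximalRealSubfield F.K)) F.K (IsCMField.complexConj F.K) 1 (Matrix.diagonal (lineVec F.K (a : F.K)))).range, ĉ ((UnitaryGroup.adelicInr
          (↥(maximalRealSubfield F.K)) F.K (IsCMField.complexConj F.K) 3 1 (Matrix.diagonal (frameD V)) (Matrix.diagonal (lineVec F.K (a : F.K)))) γ) = 1) →
      Continuous ĉ →
      ∀ (hν : ∀ γU ∈ CMRat F.K (frameD V), ((cmLineChar₀ F.K finProdFinEquiv e₁ (frameD V) (frameD_real V) (frameD_ne V) (dW (cDiag Φ ι₁ (a : F.K) ha ha0).D) (dW_real (cDiag Φ ι₁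
          (a : F.K) ha ha0).D) (dW_ne (cDiag Φ ι₁ (a : F.K) ha ha0).D) (compat_plane V Φ ι₁ (a : F.K) ha ha0) (compat_line₀ V Φ ι₁ (a : F.K) ha ha0) (compat_line₁ V Φ ι₁
          (a : F.K) ha ha0)).comp (MonoidHom.inl _ _) * (ĉ.comp (UnitaryGroup.adelicInl (↥(maximalRealSubfield F.K)) F.K (IsCMField.complexConj
          F.K) 3 1 (Matrix.diagonal (frameD V)) (Matrix.diagonal (lineVec F.K (a : F.K)))))⁻¹) γU = 1)
        (hνc : Continuous fun v => ((((cmLineChar₀ F.K finProdFinEquiv e₁ (frameD V) (frameD_real V) (frameD_ne V) (dW (cDiag Φ ι₁ (a : F.K) ha ha0).D) (dW_real (cDiag Φ ι₁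
            (a : F.K) ha ha0).D) (dW_ne (cDiag Φ ι₁ (a : F.K) ha ha0).D) (compat_plane V Φ ι₁ (a : F.K) ha ha0) (compat_line₀ V Φ ι₁ (a : F.K) ha ha0) (compat_line₁ V Φ ι₁
            (a : F.K) ha ha0)).comp (MonoidHom.inl _ _) * (ĉ.comp (UnitaryGroup.adelicInl (↥(maximalRealSubfield F.K)) F.K (IsCMField.complexConj F.K) 3 1 (Matrix.diagonal (frameD V))
            (Matrix.diagonal (lineVec F.K (a : F.K)))))⁻¹) v : ℂˣ) : ℂ))
        (A : ∀ k : Fin 4, ArchLineInput V (lineRepT V (cDiag Φ ι₁ (a : F.K) ha ha0).D (compat_plane V Φ ι₁ (a : F.K) ha ha0) (compat_line₀ V Φ ι₁ (a : F.K) ha ha0) (compat_line₁ V Φ ι₁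
            (a : F.K) ha ha0) (compat_line₂ V Φ ι₁ (a : F.K) ha ha0) (compat_line₃ V Φ ι₁ (a : F.K) ha ha0) (1 : CMAdelic F.K (frameD V) × CMAdelic F.K (dW (cDiag Φ ι₁
            (a : F.K) ha ha0).D) →* ℂˣ) ((cmLineChar₀ F.K finProdFinEquiv e₁ (frameD V) (frameD_real V)
            (frameD_ne V) (dW (cDiag Φ ι₁ (a : F.K) ha ha0).D) (dW_real (cDiag Φ ι₁ (a : F.K) ha ha0).D) (dW_ne (cDiag Φ ι₁ (a : F.K) ha ha0).D) (compat_plane V Φ ι₁ (a : F.K) ha ha0)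
                (compat_line₀ V Φ ι₁ (a : F.K) ha ha0) (compat_line₁ V Φ ι₁ (a : F.K) ha ha0)).comp (MonoidHom.inl _ _) * (ĉ.comp (UnitaryGroup.adelicInl (↥(maximalRealSubfield F.K)) F.K
                (IsCMField.complexConj F.K) 3 1 (Matrix.diagonal (frameD V)) (Matrix.diagonal (lineVec F.K (a : F.K)))))⁻¹) k))
        (harm : ∀ (u : ↥(stabilizer U21 x₀)) (ℓ : Module.Dual ℂ (Fin 2 → ℂ)),
          lineOmega_zero V (cDiag Φ ι₁ (a : F.K) ha ha0).D (compat_plane V Φ ι₁ (a : F.K) ha ha0) (compat_line₀ V Φ ι₁ (a : F.K)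
              ha ha0) (compat_line₁ V Φ ι₁ (a : F.K) ha ha0) (etaT₀ V (cDiag Φ ι₁ (a : F.K) ha ha0).D (1 : CMAdelic F.K (frameD V) × CMAdelic F.K (dW (cDiag Φ
              ι₁ (a : F.K) ha ha0).D) →* ℂˣ) ((cmLineChar₀ F.K finProdFinEquiv e₁ (frameD V) (frameD_real V) (frameD_ne V) (dW (cDiag Φ ι₁ (a : F.K) ha ha0).D) (dW_real (cDiag Φ
              ι₁ (a : F.K) ha ha0).D) (dW_ne (cDiag Φ ι₁ (a : F.K) ha ha0).D) (compat_plane V Φ ι₁ (a : F.K) ha ha0)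
              (compat_line₀ V Φ ι₁ (a : F.K) ha ha0) (compat_line₁ V Φ ι₁ (a : F.K) ha ha0)).comp (MonoidHom.inl _ _) * (ĉ.comp (UnitaryGroup.adelicInl (↥(maximalRealSubfield F.K)) F.K
                  (IsCMField.complexConj F.K) 3 1 (Matrix.diagonal (frameD V)) (Matrix.diagonal (lineVec F.K (a : F.K)))))⁻¹)) (u : U21) ((blockFamilyOfAt F.K e₁ (frameD V) (frameD_real
              V) (frameD_ne V) (lineVec F.K (dW (cDiag Φ ι₁ (a : F.K) ha ha0).D 0)) (fun _ => dW_real (cDiag Φ ι₁ (a : F.K) ha ha0).D 0) (fun _ => dW_ne (cDiag Φ ι₁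
                  (a : F.K) ha ha0).D 0) ι₁ (blockPosEquiv V) (blockNegEquiv V) (posIdxEquivUnit hpos) (negIdxEquivEmpty hpos) (degOnePDual Empty) (binvPi 1)) ℓ) =
            (blockFamilyOfAt F.K e₁ (frameD V) (frameD_real V) (frameD_ne V) (lineVec F.K (dW (cDiag Φ ι₁ (a : F.K) ha ha0).D 0)) (fun _ => dW_real (cDiag Φ ι₁ (a : F.K) ha ha0).D 0)
                (fun _ => dW_ne (cDiag Φ ι₁ (a : F.K) ha ha0).D 0) ι₁ (blockPosEquiv V) (blockNegEquiv V) (posIdxEquivUnit hpos) (negIdxEquivEmpty hpos) (degOnePDual Empty) (binvPi 1))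
                ((BallForms.isPullbackCocycle_cotangentCocycle.weightOf x₀).dual u ℓ))
        (hdef : ∀ g : UnitaryGroup.arch (↥(maximalRealSubfield F.K)) F.K (IsCMField.complexConj F.K) 3 V.Hm,
          UnitaryGroup.archAt (↥(maximalRealSubfield F.K)) F.K (IsCMField.complexConj F.K) 3 V.Hm (UnitaryGroup.cmPlace F.K ι₁) (NumberField.complexConj_smul_infinitePlace F.K _)
              (IsCMField.complexConj_ne_one F.K) g = 1 →
          ∀ (ℓ : Module.Dual ℂ (Fin 2 → ℂ)) (Φf : FinSB (↥(maximalRealSubfield F.K)) (Fin 3)),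
            lineRepOf V (cDiag Φ ι₁ (a : F.K) ha ha0).D (compat_plane V Φ ι₁ (a : F.K) ha ha0) (compat_line₀ V Φ ι₁ (a : F.K) ha
                ha0) (compat_line₁ V Φ ι₁ (a : F.K) ha ha0) (compat_line₂ V Φ ι₁ (a : F.K) ha ha0) (compat_line₃ V Φ ι₁ (a : F.K) ha ha0) (etaT₀ V (cDiag Φ ι₁ (a : F.K) ha ha0).D
                    (1 : CMAdelic F.K (frameD V) × CMAdelic F.K (dW (cDiag Φ ι₁ (a : F.K) ha ha0).D) →* ℂˣ)
                ((cmLineChar₀ F.K finProdFinEquiv e₁ (frameD V) (frameD_real V) (frameD_ne V) (dW (cDiag Φ ι₁ (a : F.K) ha ha0).D) (dW_real (cDiag Φ ι₁ (a : F.K) ha ha0).D)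
                (dW_ne (cDiag Φ ι₁ (a : F.K) ha ha0).D) (compat_plane V Φ ι₁ (a : F.K) ha ha0) (compat_line₀ V Φ ι₁ (a : F.K) ha
                ha0) (compat_line₁ V Φ ι₁ (a : F.K) ha ha0)).comp (MonoidHom.inl _ _) * (ĉ.comp (UnitaryGroup.adelicInl (↥(maximalRealSubfield F.K)) F.K (IsCMField.complexConj F.K) 3 1
                    (Matrix.diagonal
                (frameD V)) (Matrix.diagonal (lineVec F.K (a : F.K)))))⁻¹))
                (etaT₁ V (cDiag Φ ι₁ (a : F.K) ha ha0).D (1 : CMAdelic F.K (frameD V) × CMAdelic F.K (dW (cDiag Φ ι₁ (a : F.K) ha ha0).D) →* ℂˣ) ((cmLineChar₀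
                    F.K finProdFinEquiv e₁ (frameD V) (frameD_real V) (frameD_ne V) (dW (cDiag Φ ι₁ (a : F.K) ha ha0).D) (dW_real (cDiag Φ ι₁ (a : F.K) ha ha0).D) (dW_ne (cDiag
                    Φ ι₁ (a : F.K) ha ha0).D) (compat_plane V Φ ι₁ (a : F.K) ha ha0) (compat_line₀ V Φ ι₁ (a : F.K) ha ha0)
                    (compat_line₁ V Φ ι₁ (a : F.K) ha ha0)).comp (MonoidHom.inl _ _) * (ĉ.comp (UnitaryGroup.adelicInl (↥(maximalRealSubfield F.K)) F.K (IsCMField.complexConj F.K) 3 1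
                        (Matrix.diagonal (frameD
                    V)) (Matrix.diagonal (lineVec F.K (a : F.K)))))⁻¹)) (eta₂ V (cDiag Φ ι₁ (a : F.K) ha ha0).D (1 : CMAdelic F.K (frameD V) × CMAdelic
                    F.K (dW (cDiag Φ ι₁ (a : F.K) ha ha0).D) →* ℂˣ)) (eta₃ V (cDiag Φ ι₁ (a : F.K) ha ha0).D (1 : CMAdelic F.K (frameD V) × CMAdelic
                    F.K (dW (cDiag Φ ι₁ (a : F.K) ha ha0).D) →* ℂˣ)) 0
                (HodgeCM.Adelic.regimeEquiv F V.Hm hV (UnitaryGroup.archToAdelic (↥(maximalRealSubfield F.K)) F.K (IsCMField.complexConj F.K) 3 V.Hm g), 1)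
                (piSchwartzBruhatEquiv (↥(maximalRealSubfield F.K)) (Fin 3) ((blockFamilyOfAt F.K e₁ (frameD V) (frameD_real V) (frameD_ne V) (lineVec F.K (dW (cDiag Φ ι₁
                    (a : F.K) ha ha0).D 0)) (fun _ =>
                    dW_real (cDiag Φ ι₁ (a : F.K) ha ha0).D 0) (fun _ => dW_ne (cDiag Φ ι₁ (a : F.K) ha ha0).D 0) ι₁ (blockPosEquiv V) (blockNegEquiv V) (posIdxEquivUnit hpos)
                        (negIdxEquivEmpty
                    hpos) (degOnePDual Empty) (binvPi 1)) ℓ ⊗ₜ[ℂ] Φf)) =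
              piSchwartzBruhatEquiv (↥(maximalRealSubfield F.K)) (Fin 3) ((blockFamilyOfAt F.K e₁ (frameD V) (frameD_real V) (frameD_ne V) (lineVec F.K (dW (cDiag Φ ι₁
                  (a : F.K) ha ha0).D 0)) (fun _ =>
                  dW_real (cDiag Φ ι₁ (a : F.K) ha ha0).D 0) (fun _ => dW_ne (cDiag Φ ι₁ (a : F.K) ha ha0).D 0) ι₁ (blockPosEquiv V) (blockNegEquiv V) (posIdxEquivUnit hpos)
                      (negIdxEquivEmpty
                  hpos) (degOnePDual Empty) (binvPi 1)) ℓ ⊗ₜ[ℂ] Φf)),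
      ∀ (hemb : (InfinitePlace.mk ι₁).embedding = ι₁) (T : GL (Fin 3) ℂ)
        (hT : (T : Matrix (Fin 3) (Fin 3) ℂ)ᴴ * (HodgeCM.HermSpace3.Hm V).map ι₁ * (T : Matrix (Fin 3) (Fin 3) ℂ) =
          Literature.Geometry.ComplexHyperbolic.BallModel.J)
        (TW : Matrix (Fin 1) (Fin 1) ↥(maximalRealSubfield F.K)) (hW : TW.IsSymm) (hWd : IsUnit TW.det) (JW : Matrix (Fin 1) (Fin 1) F.K)
        (hJW : JW = TW.map (algebraMap ↥(maximalRealSubfield F.K) F.K)) (hTW : lineW F.K TW = (lineVec F.K (a : F.K)))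
        (hρ : HasThetaMajorants fun (p : CMAdelic F.K (frameD V) × ↥(UnitaryGroup.adelic ↥(maximalRealSubfield F.K) F.K (IsCMField.complexConj F.K) 1 JW))
            (Φ' : piSchwartzBruhat ↥(maximalRealSubfield F.K) (Fin 3)) =>
          pairRep ↥(maximalRealSubfield F.K) F.K (IsCMField.complexConj F.K) 3 1 e₁ (Matrix.diagonal (frameD V)) JW
            (chiSplittingLine F.K e₁ (frameD V) (frameD_real V) (frameD_ne V) (IdeleClassGroup.toHeckeCharacter F.K μ₀) (IdeleClassGroup.isUnitary_toHeckeCharacter F.K μ₀)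
                ((Literature.RepresentationTheory.Liu2021.isOscillatorChar_toHeckeCharacter_iff μ₀).mpr hμ₀) TW hWd JW hJW) p Φ')
        [MeasurableSpace (↥(UnitaryGroup.adelic ↥(maximalRealSubfield F.K) F.K (IsCMField.complexConj F.K) 1 JW) ⧸ (UnitaryGroup.toAdelic ↥(maximalRealSubfield F.K) F.K
            (IsCMField.complexConj F.K) 1 JW).range)] [BorelSpace (↥(UnitaryGroup.adelic ↥(maximalRealSubfield F.K) F.K (IsCMField.complexConj F.K) 1 JW) ⧸
            (UnitaryGroup.toAdelic ↥(maximalRealSubfield F.K) F.K (IsCMField.complexConj F.K) 1 JW).range)]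
        [CompactSpace (CMAdelic F.K (frameD V) ⧸ CMRat F.K (frameD V))] (μW : Measure (↥(UnitaryGroup.adelic ↥(maximalRealSubfield F.K) F.K (IsCMField.complexConj F.K) 1 JW) ⧸
            (UnitaryGroup.toAdelic ↥(maximalRealSubfield F.K) F.K (IsCMField.complexConj F.K) 1 JW).range)) [IsFiniteMeasure μW]
        [SMulInvariantMeasure ↥(UnitaryGroup.adelic ↥(maximalRealSubfield F.K) F.K (IsCMField.complexConj F.K) 1 JW) (↥(UnitaryGroup.adelic ↥(maximalRealSubfield F.K) F.K
            (IsCMField.complexConj F.K) 1 JW) ⧸ (UnitaryGroup.toAdelic ↥(maximalRealSubfield F.K) F.K (IsCMField.complexConj F.K) 1 JW).range) μW] [μW.IsOpenPosMeasure]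
            (f : C((↥(UnitaryGroup.adelic ↥(maximalRealSubfield F.K) F.K (IsCMField.complexConj F.K) 1 JW) ⧸ (UnitaryGroup.toAdelic ↥(maximalRealSubfield F.K) F.K
            (IsCMField.complexConj F.K) 1 JW).range), ℂ)),
        ∃ (φ : Fin 2 → 𝓢(((Fin 3 × Fin 1) → mixedSpace ↥(maximalRealSubfield F.K)), ℂ)) (j₀ : Fin 2),
          (∀ Φf : FinSB ↥(maximalRealSubfield F.K) (Fin 3 × Fin 1),
            (fun (x : (adelicGroupData ↥(maximalRealSubfield F.K) F.K (IsCMField.complexConj F.K) 3 (HodgeCM.HermSpace3.Hm V)).Adelic) (j : Fin 2) =>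
              (thetaKernelDatum ↥(maximalRealSubfield F.K) F.K (IsCMField.complexConj F.K) 3 1 e₁ (Matrix.diagonal (frameD V)) JW (complexConj_imagUnit F.K) (imagUnit_ne_zero F.K)
                  (imagUnit_mul_self F.K) (realDiagonal_isSymm F.K (frameD V) (frameD_real V)) hW (isUnit_det_realDiagonal F.K (frameD V) (frameD_real V) (frameD_ne V)) hWd
                  (realDiagonal_map F.K (frameD V) (frameD_real V)).symm hJW
                  (chiSplittingLine F.K e₁ (frameD V) (frameD_real V) (frameD_ne V) (IdeleClassGroup.toHeckeCharacter F.K μ₀) (IdeleClassGroup.isUnitary_toHeckeCharacter F.K μ₀)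
                      ((Literature.RepresentationTheory.Liu2021.isOscillatorChar_toHeckeCharacter_iff μ₀).mpr hμ₀) TW hWd JW hJW)
                  (isCompatible_chiSplittingLine F.K e₁ (frameD V) (frameD_real V) (frameD_ne V) (IdeleClassGroup.toHeckeCharacter F.K μ₀)
                      (IdeleClassGroup.isUnitary_toHeckeCharacter F.K μ₀) ((Literature.RepresentationTheory.Liu2021.isOscillatorChar_toHeckeCharacter_iff μ₀).mpr hμ₀) TW hW hWd JW hJW)
                  hρ Set.univ (fun _ _ _ => Set.mem_univ _)).thetaLiftFun μW
                (piSBReindex ↥(maximalRealSubfield F.K) e₁ (piSchwartzBruhatEquiv ↥(maximalRealSubfield F.K) (Fin 3 × Fin 1) (φ j ⊗ₜ[ℂ] Φf))) f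
                ((cmAdelicFrameTransport F.K 3 (HodgeCM.HermSpace3.Hm V) (frameD V) (frameG V) (frame_congr V)) x)) ∈
              CotangentForms.holCotForms ↥(maximalRealSubfield F.K) F.K (IsCMField.complexConj F.K) 3 (HodgeCM.HermSpace3.Hm V) (CotangentForms.cmArchSection F.K ι₁
                  (HodgeCM.HermSpace3.Hm V) T hT) (CotangentForms.cmCompactFactor F.K ι₁ (HodgeCM.HermSpace3.Hm V) T hT)) ∧
          schwartzReindexCLM ↥(maximalRealSubfield F.K) e₁ (φ j₀) ≠ 0 ∧
          ∀ a' : UnitaryGroup.arch ↥(maximalRealSubfield F.K) F.K (IsCMField.complexConj F.K) 1 JW,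
            (HodgeCM.Model.HypCensus.archWeilRep ↥(maximalRealSubfield F.K) F.K (IsCMField.complexConj F.K) 3 1 (Matrix.diagonal (frameD V)) JW (complexConj_imagUnit F.K)
                (imagUnit_ne_zero F.K) (imagUnit_mul_self F.K) (realDiagonal_isSymm F.K (frameD V) (frameD_real V)) hW (isUnit_det_realDiagonal F.K (frameD V) (frameD_real V)
                (frameD_ne V)) hWd (realDiagonal_map F.K (frameD V) (frameD_real V)).symm hJW e₁ (chiSplittingLine F.K e₁ (frameD V) (frameD_real V) (frameD_ne V)
                (IdeleClassGroup.toHeckeCharacter F.K μ₀) (IdeleClassGroup.isUnitary_toHeckeCharacter F.K μ₀)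
                ((Literature.RepresentationTheory.Liu2021.isOscillatorChar_toHeckeCharacter_iff μ₀).mpr hμ₀) TW hWd JW hJW)
                (ThetaNonvanishing.proj_apply_eq_toSp ↥(maximalRealSubfield F.K) F.K (IsCMField.complexConj F.K) 3 1 e₁ (Matrix.diagonal (frameD V)) JW (complexConj_imagUnit F.K)
                (imagUnit_ne_zero F.K) (imagUnit_mul_self F.K) (realDiagonal_isSymm F.K (frameD V) (frameD_real V)) hW (isUnit_det_realDiagonal F.K (frameD V) (frameD_real V)
                (frameD_ne V)) hWd (realDiagonal_map F.K (frameD V) (frameD_real V)).symm hJW (isCompatible_chiSplittingLine F.K e₁ (frameD V) (frameD_real V) (frameD_ne V)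
                (IdeleClassGroup.toHeckeCharacter F.K μ₀) (IdeleClassGroup.isUnitary_toHeckeCharacter F.K μ₀)
                ((Literature.RepresentationTheory.Liu2021.isOscillatorChar_toHeckeCharacter_iff μ₀).mpr hμ₀) TW hW hWd JW hJW)))
                (1, a') (schwartzReindexCLM ↥(maximalRealSubfield F.K) e₁ (φ j₀)) =
              schwartzReindexCLM ↥(maximalRealSubfield F.K) e₁ (φ j₀) := by
  intro F ι₁ V h4 Φ μ₀ hμ₀ hw hmem χ e a he hae hV ha ha0 hpos ĉ hĉ hĉV hĉW hĉc hν hνc A harm hdef hemb T hT TW hW hWd JW hJW hTW hρ _ _ _ μW _ _ _ f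
  -- the hermitian line datum is a model datum: `TW = realDiagonal dW`, `JW = diagonal dW`, and `dW = lineVec a` by `hTW`
  obtain ⟨dW, hdW, rfl⟩ : ∃ (dW : Fin 1 → F.K) (hdW : ∀ i, IsCMField.complexConj F.K (dW i) = dW i), TW = realDiagonal F.K dW hdW :=
    ⟨lineW F.K TW, complexConj_lineW F.K TW, (realDiagonal_lineW F.K TW).symm⟩
  obtain rfl : JW = Matrix.diagonal dW := hJW.trans (realDiagonal_map F.K dW hdW)
  obtain rfl : dW = (lineVec F.K (a : F.K)) := (lineW_realDiagonal F.K dW hdW).symm.trans hTW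
  -- the letter's splitting IS the model's (★ `chiSplittingLine_realDiagonal`)
  have hsplit := chiSplittingLine_realDiagonal (L := F.K) (hχu := IdeleClassGroup.isUnitary_toHeckeCharacter F.K μ₀)
    (hχs := (Literature.RepresentationTheory.Liu2021.isOscillatorChar_toHeckeCharacter_iff μ₀).mpr hμ₀) (e₁ := e₁) (dV₁ := frameD V)
    (hdV₁ := frameD_real V) (hdV₁0 := frameD_ne V) (dW := (lineVec F.K (a : F.K))) (hdW := hdW) (hdW0 := lineVec_coe_ne_zero F.K a) (hWd := hWd) (hJW := hJW)
  have hρ' := hρ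
  rw [hsplit] at hρ'
  obtain ⟨φ, j₀, hhol, hne, hE⟩ := linePair_frame_of_packaged F V h4 Φ μ₀ hμ₀ hw hmem χ e a he hae hV ha ha0 hpos ĉ hĉ hĉV hĉW hĉc hν hνc A harm hdef
    hemb T hT hρ' μW f
  haveI hcW : CompactSpace (↥(UnitaryGroup.adelic ↥(maximalRealSubfield F.K) F.K (IsCMField.complexConj F.K) 1 (Matrix.diagonal (lineVec F.K (a : F.K)))) ⧸
      (UnitaryGroup.toAdelic ↥(maximalRealSubfield F.K) F.K (IsCMField.complexConj F.K) 1 (Matrix.diagonal (lineVec F.K (a : F.K)))).range) :=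
    compactSpace_quotient_range_toAdelic_line F.K _ (fun _ => ha) (fun _ => ha0)
  refine ⟨φ, j₀, fun Φf => ?_, hne, fun a' => ?_⟩
  · refine (congrArg (fun θ => θ ∈ CotangentForms.holCotForms ↥(maximalRealSubfield F.K) F.K (IsCMField.complexConj F.K) 3 (HodgeCM.HermSpace3.Hm V) (CotangentForms.cmArchSection F.K ι₁
      (HodgeCM.HermSpace3.Hm V) T hT) (CotangentForms.cmCompactFactor F.K ι₁ (HodgeCM.HermSpace3.Hm V) T hT)) ?_).mpr (hhol Φf)
    funext x j
    simp only [ThetaKernelDatum.thetaLiftFun_apply]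
    exact thetaLift_congr_splitting _ _ _ _ _ _ _ _ _ _ _ _ _ _ _ _ _ hsplit _ _ _ _ _ _ _ _ _ _ _
  · rw [K2E2CapArchPairFixedNeZero.archWeilRep_congr_splitting _ _ _ _ _ _ _ _ _ _ _ _ _ _ _ _ e₁ _ _ hsplit
      (ThetaNonvanishing.proj_apply_eq_toSp ↥(maximalRealSubfield F.K) F.K (IsCMField.complexConj F.K) 3 1 e₁ (Matrix.diagonal (frameD V)) (Matrix.diagonal (lineVec F.K (a : F.K)))
          (complexConj_imagUnit F.K) (imagUnit_ne_zero F.K) (imagUnit_mul_self F.K) (realDiagonal_isSymm F.K (frameD V) (frameD_real V)) (realDiagonal_isSymm F.K _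
          (complexConj_lineVec_coe F.K a)) (isUnit_det_realDiagonal F.K (frameD V) (frameD_real V) (frameD_ne V)) (isUnit_det_realDiagonal F.K _ (complexConj_lineVec_coe F.K a)
          (lineVec_coe_ne_zero F.K a)) (realDiagonal_map F.K (frameD V) (frameD_real V)).symm (realDiagonal_map F.K _ (complexConj_lineVec_coe F.K a)).symm
          (isCompatible_chiSplitting F.K e₁ (frameD V) (frameD_real V) (frameD_ne V) _ (complexConj_lineVec_coe F.K a) (lineVec_coe_ne_zero F.K a)
          (IdeleClassGroup.toHeckeCharacter F.K μ₀) (IdeleClassGroup.isUnitary_toHeckeCharacter F.K μ₀)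
          ((Literature.RepresentationTheory.Liu2021.isOscillatorChar_toHeckeCharacter_iff μ₀).mpr hμ₀)))]
    exact hE a'

end Summit.HodgeConjecture.HodgeConjecture.Cruxes.H413.K2E2CapArchPairHolCotLineCast

end
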